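import Summits.QuantumFields.BalabanUV.T4Continuum.Support.NE3RightInverseLetters
import Summits.QuantumFields.BalabanUV.T4Continuum.Support.NE3EnergySource
import Summits.QuantumFields.BalabanUV.T4Continuum.Support.NE7MinActC2AllDataUniform
import Summits.QuantumFields.BalabanUV.T4Continuum.Support.NE7OneStepConstraintCurvature
import Summits.QuantumFields.BalabanUV.T4Continuum.Support.NE7EffectiveFormCoarseCurlAllLevels
import Summits.QuantumFields.BalabanUV.T4Continuum.Support.NE7TorusChartDecoding
import HarnessLib

/-!
# NE7MultiplierDensity — THE LAGRANGE MULTIPLIER OF THE CONSTRAINED MINIMAL ACTION HAS `ℓ¹`-DENSITY `O(ε)`, UNIFORMLY IN THE LEVEL AND IN THE VOLUME: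
# `|D(minAct_{j+1} ∘ chart_{V₀})(0)[γ]| ≤ 2·curl1C 4 L·ε·‖γ‖_{ℓ¹(periodBox N)}` at every small datum `V₀`, every level `j`, every `γ ∈ skewSub N` (`d = 4`, every `U(n)`, `L ≥ 2`) —
# and, with ✓ `NE7OneStepConstraintCurvature`, THE TOP-LEVEL MULTIPLIER TERM: `|Dm(0)[skewPR (D²coord_W(0)[ψ,ψ])]| ≤ 2·curl1C 4 L·ε·(4∕rho0²)·4·(2·nbRad+1)⁴·Σ_b ‖ψ̃_b‖²`
# (ROAD-G116 §6 (G3): «‖Dm(0)‖ = O(action density)», typed and proved; the `i = j` term of the multiplier-term series)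

Cell `pub-balaban`, rung (B)+1 sub-cell t4, lineage `b2b-balaban-t4-ne7b-p1` (row NE7b OWNER + CRUX PROVER; junction service for row NE7, ruling R-OWNER-149-1 (2)), generation 161.
Index `t4/b2b-balaban-t4-ne7b-p1/g161/INDEX.md`; memo `g161/records/SCOPING-G3.md`.  MECHANISM: the road's multiplier identity `w·D𝒜(0)[Z] = Dm(0)[levelQ′ Z]`
(✓ `NE7MinActC2AllDataUniform.multiplier_eq_fderiv_minAct_allData_uniform`, `w = stepWt⁻ʲ⁻¹ = 1` at `d = 4`, ✓ `stepWt_four`), the dictionary `D𝒜(0)[Z] = dAction U♯ Z̃` (§1),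
row NE3's smooth CURVED right inverse `rightInvW` of the linearised `(j+1)`-fold average (route Π-R; ✓ `NE3SmoothRightInverseW.dirIter_rightInvW`, its (R3) letter
✓ `NE3RightInverseLetters.sum_norm_curl_rightInvW_le`: `Σ_{perWin}‖curl_{U♯}(rightInvW φ)‖ ≤ c₃·M^{d−2}·‖φ‖_{ℓ¹(periodBox N)}`, `M = L^{j+1}`), the dictionary `levelQ′ ↔ dirIter`
(§1, the pattern of the road's gen-69 ✓ `NE7MultiplierOfRightInverse`, whose import closure — `NE7CriticalMultiplier` — does not build on the farm at the time of filing, hence is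
not imported), and the first-variation bound `|dAction U Z| ≤ a·Σ‖curl_U Z‖` (✓ `NE3EnergySource.abs_firstVariation_le`) at the class radius `a = ε∕M²`: every `M` cancels at `d = 4`.
WHAT ([folklore]; 0 def, 0 sorry):
* §1 `chartDir_id_eq_extDir`; **`fderiv_fineAction_chart_subtype_apply`** (`D(fineAction(·)(W) ∘ chart_U ∘ ι)(0)[Z] = dAction U (extDir Z) W`); `coe_levelQ'_resDir_eq`,
  **`levelQ'_resDir_eq_skewPR_dirIter`** (`levelQ′ L M′ j W₁ (res φ) = skewPR (res (dirIter L (j+1) W₁ φ))` in row NE3-R2's multi-level class — every `d`);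
  **`levelQ'_resDir_rightInvW_eq`** (`levelQ′ (res (rightInvW … φ)) = skewPR (res φ)`); `dirL1_extDir_skewPR_le`.
* §2 **`multiplier_density_allData_uniform`** — `∃ ε₀ > 0 ∀ 0 < ε ≤ ε₀ ∀ N ≥ 1 ∃ δ_V > 0 ∀ j ∀ V₀` (unitary, `N`-periodic, `δ_V`-small) `∀ U♯` minimiser `∀ γ ∈ skewSub 4 n N`:
  `|D(minAct 4 (sfClass 4 L N ε) L N (j+1) ∘ chart_{V₀})(0)[γ]| ≤ 2·curl1C 4 L·ε·dirL1 (extDir N γ) (periodBox N)`.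
* §3 **`multiplierTerm_top_le_allData_uniform`** — in the same frame, for every base `W` one averaging step below the top (unitary, `SmallField W a`, `512·5·8·L²a ≤ 1`) and every
  direction `ψ` of the torus `[0, LN)⁴`: `|Dm(0)[skewPR N (D²(coord L N W)(0)[ψ,ψ])]| ≤ 2·curl1C 4 L·ε·((4∕rho0 4 L²)·(4·(2·nbRad 4 L+1)^4)·dirSq ψ̃ (periodBox (L·N)))` — the `i = j`
  term of the series `Σ_i Dm(0)[levelQ′-tail (D²coord_{U_i}[ψ^{(i)},ψ^{(i)}])]` of ✓ `NE7ConstraintSecondDerivativeRecursion`, bilinear-local and volume-free.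
HONEST FRAMING (page 1): composition of landed kernel theorems; constants BY NAME (`curl1C`, `thetaLoc`, `cruxC`, `rho0`, `nbRad` of rows NE3 ∕ NE3-R2), not optimised; radii existential as
in the road's files (`∃ δ_V ∀ j` by ✓ p830442); OUR minimisers (B11 (8) with `sfClass`); nothing of Bałaban's asserted; NOT (G) (the inner terms `i < j` of the series need the
gauge-slice bookkeeping of ✓ `NE7BorderedHessianGaugeDegenerate` + the straight-tower letters — the road's assembly), NOT NE7 as a spine node, NOT NE3; row NE7b NOT PRINTED ∕ NOT PROVED;
spine 0∕9; finite T⁴ rung (B)+1 — NOT infinite volume, NOT mass gap, NOT BetaPertH, NOT Clay.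
-/

set_option autoImplicit false

open scoped BigOperators Matrix Matrix.Norms.L2Operator Topology
open NormedSpace Finset Set Filter Metric

namespace Summit.QuantumFields.BalabanUV.T4Continuum.NE7MultiplierDensity

open Literature.MathematicalPhysics.QuantumFieldTheory.Balaban1983to89
open B7Prop1Explicit B7Prop2Explicit MatrixLog UnitaryModel
open T4AveragingDeficitWall (IsUnitaryCfg IsSkewDir SmallField fineAction vary vary_zero curl dirL1 dirSq box)
open T4AveragingDeficitWallBoundary (IsPeriodicCfg periodBox)
open AveragingDeficitPeriodicCounting (IsPeriodicDir)
open AveragingDeficitTorusChart (TDir chart chartDir extDir resDir redN_boxVec skewP extDir_resDir resDir_extDir isPeriodicDir_extDir)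
open AveragingDeficitChartCalculus (cavg coord hasDerivAt_fineAction_chartDir contDiffAt_fineAction_chart)
open AveragingDeficitFermat (isPeriodicCfg_cavg)
open AveragingDeficitTwoLevelPrep (skewSub mem_skewSub skewPR skewPF skewPF_apply skewPF_of_mem)
open AveragingDeficitMultiLevelPrep (tower levelQ levelQ' LevelSmall cpush natCast_tower_succ fderiv_coord_resDir ball_of_small isPeriodicDir_cpush)
open AveragingDeficitMultiLevelBridge (tower_eq)
open MinimalActionLevels (perWin stepWt)
open MinimalActionSandwich (IsMinimiser minAct)
open MinimalActionRate (sfClass)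
open NE3HessForm (dAction hasDerivAt_fineAction_vary_at)
open NE3EnergySource (abs_firstVariation_le fhol_sub_one_le_of_smallField)
open NE3TangentCovariantTower (dirIter step_small)
open NE3SmoothRightInverseW (rightInvW isSkewDir_rightInvW isPeriodicDir_rightInvW dirIter_rightInvW)
open NE3HatInvCurlLetters (curl1C curl1C_nonneg)
open NE3QbarIterCovLiftPrep (cruxC)
open NE3RightInverseSolveLetters (thetaLoc cruxC_nonneg thetaLoc_nonneg cruxC_le_thetaLoc)
open NE3RightInverseLetters (sum_norm_curl_rightInvW_le)
open NE7MinimalOrbitDatumContinuity (thresholds)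
open NE7MinActC2AllDataUniform (multiplier_eq_fderiv_minAct_allData_uniform)
open NE7EffectiveFormCoarseCurlAllLevels (stepWt_four)
open NE7TorusChartDecoding (norm_skewP_le)
open BlockAverageVaryHolo (nbRad)
open BlockAverageVaryDisc (rho0 rho0_pos)
open NE7OneStepConstraintCurvature (sum_norm_fderiv_fderiv_coord_le)
open AveragingDeficitDerivCore (dirL1_nonneg)

noncomputable section

variable {d : ℕ} {n : Type} [Fintype n] [DecidableEq n]

/-! ## §1 Dictionaries: `D𝒜(0) = dAction`, `levelQ′ ↔ dirIter`, the right inverse as a preimage -/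

omit [Fintype n] [DecidableEq n] in
/-- The identity insert: `chartDir id N ψ = extDir N ψ`. [folklore] -/
theorem chartDir_id_eq_extDir (N : ℕ) [NeZero N] (ψ : TDir d n N) :
    chartDir (ContinuousLinearMap.id ℝ (Matrix n n ℂ)) N ψ = extDir N ψ := rfl

/-- **`D(fineAction(·)(W) ∘ chart_U ∘ ι)(0)[Z] = dAction U (extDir Z) W`** for `Z ∈ skewSub M` (the chart action restricted to the skew directions). [folklore] -/
theorem fderiv_fineAction_chart_subtype_apply {M : ℕ} [NeZero M] (U : Site d → Fin d → (Matrix n n ℂ)ˣ) (W : Finset (T4AveragingDeficitWall.Plaq d))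
    (Z : ↥(skewSub d n M)) :
    fderiv ℝ (fun Φ : ↥(skewSub d n M) => fineAction (chart (ContinuousLinearMap.id ℝ (Matrix n n ℂ)) M U (Φ : TDir d n M)) W) 0 Z
      = dAction U (extDir M (Z : TDir d n M)) W := by
  have hF : ContDiffAt ℝ 1 (fun ψ : TDir d n M => fineAction (chart (ContinuousLinearMap.id ℝ (Matrix n n ℂ)) M U ψ) W)
      ((skewSub d n M).subtypeL (0 : ↥(skewSub d n M))) := by
    rw [map_zero]; exact contDiffAt_fineAction_chart (m := 1) _ M U W 0
  have hc := (hF.differentiableAt one_ne_zero).hasFDerivAt.comp (0 : ↥(skewSub d n M)) (skewSub d n M).subtypeL.hasFDerivAt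
  rw [show (fun Φ : ↥(skewSub d n M) => fineAction (chart (ContinuousLinearMap.id ℝ (Matrix n n ℂ)) M U (Φ : TDir d n M)) W)
      = (fun ψ : TDir d n M => fineAction (chart (ContinuousLinearMap.id ℝ (Matrix n n ℂ)) M U ψ) W) ∘ (skewSub d n M).subtypeL from rfl,
    hc.fderiv, map_zero, ContinuousLinearMap.comp_apply, Submodule.subtypeL_apply]
  have h1 := hasDerivAt_fineAction_chartDir (ContinuousLinearMap.id ℝ (Matrix n n ℂ)) M U W (Z : TDir d n M)
  have h2 := hasDerivAt_fineAction_vary_at U (chartDir (ContinuousLinearMap.id ℝ (Matrix n n ℂ)) M (Z : TDir d n M)) W 0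
  rw [vary_zero] at h2
  rw [h1.unique h2, chartDir_id_eq_extDir]

/-- **`levelQ′` IS THE `𝔲(n)` PART OF THE TORUS READING OF `dirIter`** (row NE3-R2's multi-level small-field class at the base `W₁`: unitary, period `L·tower L M′ j`, `SmallField W₁ x`,
`LevelSmall d L j x`), for every `(L·tower L M′ j)`-periodic direction `φ` of `ℤ^d`:
`(levelQ′ L M′ j W₁ (res φ) : TDir) = (skewPR M′ (res (dirIter L (j+1) W₁ φ)) : TDir)` (induction through the tower with ✓ `fderiv_coord_resDir`; the pattern of the road's
gen-69 dictionary). [folklore] -/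
theorem coe_levelQ'_resDir_eq [Nonempty n] {L M' : ℕ} [NeZero L] [NeZero M'] (hL : 1 ≤ L) (j : ℕ) :
    ∀ {W₁ : Site d → Fin d → (Matrix n n ℂ)ˣ} {x : ℝ}, IsUnitaryCfg W₁ → IsPeriodicCfg W₁ ((L : ℤ) * (tower L M' j : ℕ)) →
    0 ≤ x → LevelSmall d L j x → SmallField W₁ x → ∀ {φ : Site d → Fin d → (Matrix n n ℂ)},
    IsPeriodicDir φ ((L * tower L M' j : ℕ) : ℤ) →
      ((levelQ' L M' j W₁ (resDir (L * tower L M' j) φ) : ↥(skewSub d n M')) : TDir d n M')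
        = ((skewPR (d := d) (n := n) M' (resDir M' (dirIter L (j + 1) W₁ φ)) : ↥(skewSub d n M')) : TDir d n M') := by
  induction j with
  | zero =>
      intro W₁ x hW₁ _ hx hs hW₁x φ hφP
      have hφP0 : IsPeriodicDir φ ((L * M' : ℕ) : ℤ) := hφP
      have hval : ((levelQ' L M' 0 W₁ (resDir (L * tower L M' 0) φ) : ↥(skewSub d n M')) : TDir d n M')
          = skewPF M' ((fderiv ℝ (coord (ContinuousLinearMap.id ℝ (Matrix n n ℂ)) L M' W₁) 0) (resDir (L * M') φ)) := rfl
      rw [hval, fderiv_coord_resDir (N := M') (ball_of_small hL hW₁ hx hs hW₁x) hφP0]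
      rfl
  | succ j ih =>
      intro W₁ x hW₁ hW₁P hx hs hW₁x φ hφP
      obtain ⟨_, hcu, hr0, hcx⟩ := step_small hL hW₁ hx hs.1 hW₁x
      have hφP' : IsPeriodicDir φ ((L : ℤ) * (L * tower L M' j : ℕ)) := by
        have e : ((L * tower L M' (j + 1) : ℕ) : ℤ) = (L : ℤ) * (L * tower L M' j : ℕ) := by
          simp only [tower]; push_cast; ring
        rw [e] at hφP; exact hφP
      have hW₁P' : IsPeriodicCfg (cavg L W₁) ((L : ℤ) * (tower L M' j : ℕ)) := by
        have h := isPeriodicCfg_cavg L (tower L M' (j + 1)) hW₁P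
        rw [natCast_tower_succ] at h
        exact h
      have hval : ((levelQ' L M' (j + 1) W₁ (resDir (L * tower L M' (j + 1)) φ) : ↥(skewSub d n M')) : TDir d n M')
          = (((levelQ' L M' j (cavg L W₁)).comp (fderiv ℝ (coord (ContinuousLinearMap.id ℝ (Matrix n n ℂ)) L (L * tower L M' j) W₁) 0)
              (resDir (L * (L * tower L M' j)) φ) : ↥(skewSub d n M')) : TDir d n M') := rfl
      rw [hval, ContinuousLinearMap.comp_apply, fderiv_coord_resDir (N := L * tower L M' j) (ball_of_small hL hW₁ hx hs.1 hW₁x) hφP]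
      exact ih hcu hW₁P' hr0 hs.2 hcx (isPeriodicDir_cpush L _ hW₁P hφP')

/-- The same in `skewSub`: `levelQ′ L M′ j W₁ (res φ) = skewPR M′ (res (dirIter L (j+1) W₁ φ))`. [folklore] -/
theorem levelQ'_resDir_eq_skewPR_dirIter [Nonempty n] {L M' : ℕ} [NeZero L] [NeZero M'] (hL : 1 ≤ L) (j : ℕ)
    {W₁ : Site d → Fin d → (Matrix n n ℂ)ˣ} {x : ℝ} (hW₁ : IsUnitaryCfg W₁) (hW₁P : IsPeriodicCfg W₁ ((L : ℤ) * (tower L M' j : ℕ)))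
    (hx : 0 ≤ x) (hs : LevelSmall d L j x) (hW₁x : SmallField W₁ x) {φ : Site d → Fin d → (Matrix n n ℂ)}
    (hφP : IsPeriodicDir φ ((L * tower L M' j : ℕ) : ℤ)) :
    levelQ' L M' j W₁ (resDir (L * tower L M' j) φ) = skewPR (d := d) (n := n) M' (resDir M' (dirIter L (j + 1) W₁ φ)) :=
  Subtype.ext (coe_levelQ'_resDir_eq hL j hW₁ hW₁P hx hs hW₁x hφP)

section RightInv

variable [Nonempty n] {L : ℕ} [NeZero L] (hL : 2 ≤ L) (k : ℕ) {N : ℕ} [NeZero N] {W : Site d → Fin d → (Matrix n n ℂ)ˣ} {x : ℝ}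
  (hWu : IsUnitaryCfg W) (hWP : IsPeriodicCfg W ((tower L N (k + 1) : ℕ) : ℤ)) (hx : 0 ≤ x) (hs : LevelSmall d L k x) (hWx : SmallField W x)
  (hθ : cruxC d L * (((L : ℝ) ^ (k + 1)) ^ 2 * x) < 1)

include hWP in
/-- **ROW NE3's CURVED RIGHT INVERSE IS A PREIMAGE UNDER `levelQ′`**: for a skew `N`-periodic `φ`, `levelQ′ L N k W (res (rightInvW … φ)) = skewPR N (res φ)`. [folklore] -/
theorem levelQ'_resDir_rightInvW_eq {φ : Site d → Fin d → Matrix n n ℂ} (hφ : IsSkewDir φ) (hφP : IsPeriodicDir φ (N : ℤ)) :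
    levelQ' L N k W (resDir (L * tower L N k) (rightInvW hL k hWu hx hs hWx N hθ hφ)) = skewPR (d := d) (n := n) N (resDir N φ) := by
  have hL1 : 1 ≤ L := by omega
  have hWP' : IsPeriodicCfg W ((L : ℤ) * (tower L N k : ℕ)) := by
    have e : ((tower L N (k + 1) : ℕ) : ℤ) = (L : ℤ) * (tower L N k : ℕ) := natCast_tower_succ L N k
    rw [e] at hWP; exact hWP
  have hRP : IsPeriodicDir (rightInvW hL k hWu hx hs hWx N hθ hφ) ((L * tower L N k : ℕ) : ℤ) :=
    isPeriodicDir_rightInvW hL k hWu hWP hx hs hWx hθ hφ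
  rw [levelQ'_resDir_eq_skewPR_dirIter hL1 k hWu hWP' hx hs hWx hRP, dirIter_rightInvW hL k hWu hWP hx hs hWx hθ hφ hφP]

end RightInv

/-- The `ℓ¹` norm of a skew-projected torus field over one period is at most the sum of the norms of the field's components (`‖skewP Y‖ ≤ ‖Y‖`). [folklore] -/
theorem dirL1_extDir_skewPR_le {N : ℕ} [NeZero N] (Φ : TDir d n N) :
    dirL1 (extDir N ((skewPR (d := d) (n := n) N Φ : ↥(skewSub d n N)) : TDir d n N)) (periodBox (d := d) N)
      ≤ ∑ y : Fin d → Fin N, ∑ κ : Fin d, ‖Φ y κ‖ := by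
  unfold dirL1
  rw [periodBox, Finset.sum_image fun r _ r' _ h => T4TermwiseTorus.boxVec_injective N h]
  refine Finset.sum_le_sum fun r _ => Finset.sum_le_sum fun κ _ => ?_
  simp only [extDir, redN_boxVec]
  show ‖(skewPF N Φ) r κ‖ ≤ ‖Φ r κ‖
  rw [skewPF_apply]
  exact norm_skewP_le _

/-! ## §2 The density of the multiplier -/

/-- **THE LAGRANGE MULTIPLIER HAS `ℓ¹`-DENSITY `O(ε)`, UNIFORMLY IN THE LEVEL AND IN THE VOLUME** (see the module docstring). [folklore] -/
theorem multiplier_density_allData_uniform [Nonempty n] {L : ℕ} [NeZero L] (hL : 2 ≤ L) :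
    ∃ ε₀ : ℝ, 0 < ε₀ ∧ ∀ ε : ℝ, 0 < ε → ε ≤ ε₀ → ∀ (N : ℕ) [NeZero N], 1 ≤ N → ∃ δV : ℝ, 0 < δV ∧ ∀ j : ℕ,
        ∀ V₀ ∈ {V : Site 4 → Fin 4 → (Matrix n n ℂ)ˣ | IsUnitaryCfg V ∧ IsPeriodicCfg V (N : ℤ) ∧ SmallField V δV},
        ∀ Us : Site 4 → Fin 4 → (Matrix n n ℂ)ˣ, IsMinimiser 4 (sfClass 4 L N ε) L N (j + 1) V₀ Us →
        ∀ γ : ↥(skewSub 4 n N),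
          |fderiv ℝ (fun y : ↥(skewSub 4 n N) => minAct 4 (sfClass 4 L N ε) L N (j + 1) (chart (ContinuousLinearMap.id ℝ (Matrix n n ℂ)) N V₀ (y : TDir 4 n N))) 0 γ|
            ≤ 2 * curl1C 4 L * ε * dirL1 (extDir N (γ : TDir 4 n N)) (periodBox (d := 4) N) := by
  obtain ⟨ε₁, hε₁, T⟩ := thresholds (n := n) hL
  obtain ⟨ε₂, hε₂, Mu⟩ := multiplier_eq_fderiv_minAct_allData_uniform (n := n) hL
  have hθ0 := thetaLoc_nonneg 4 L
  set ε₃ : ℝ := 1 / (2 * (thetaLoc 4 L + 1)) with hε₃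
  have hε₃pos : 0 < ε₃ := by rw [hε₃]; positivity
  refine ⟨min ε₁ (min ε₂ (min 1 ε₃)), lt_min hε₁ (lt_min hε₂ (lt_min one_pos hε₃pos)), fun ε hε hεle N _ hN => ?_⟩
  have hε1 : ε ≤ ε₁ := hεle.trans (min_le_left _ _)
  have hε2 : ε ≤ ε₂ := hεle.trans ((min_le_right _ _).trans (min_le_left _ _))
  have hεone : ε ≤ 1 := hεle.trans ((min_le_right _ _).trans ((min_le_right _ _).trans (min_le_left _ _)))
  have hε3 : ε ≤ ε₃ := hεle.trans ((min_le_right _ _).trans ((min_le_right _ _).trans (min_le_right _ _)))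
  have hθε : thetaLoc 4 L * ε ≤ 1 / 2 := by
    have h1 : thetaLoc 4 L * ε ≤ thetaLoc 4 L * ε₃ := mul_le_mul_of_nonneg_left hε3 hθ0
    have h2 : thetaLoc 4 L * ε₃ ≤ 1 / 2 := by
      rw [hε₃, mul_one_div, div_le_iff₀ (by positivity)]
      nlinarith
    exact h1.trans h2
  obtain ⟨-, -, hls, -⟩ := T ε hε hε1
  obtain ⟨δV, hδV, H⟩ := Mu ε hε hε2 N hN
  refine ⟨δV, hδV, fun j V₀ hV₀ Us hUs γ => ?_⟩
  obtain ⟨-, hmult⟩ := H j V₀ hV₀ Us hUs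
  obtain ⟨hUsu, hUsP, hUsx⟩ := hUs.mem.1
  have hL1 : 1 ≤ L := le_trans (by norm_num) hL
  -- the class data of the base `U♯`
  have hLpos : (0 : ℝ) < ((L : ℝ) ^ (j + 1)) ^ 2 := by
    have : (0 : ℝ) < L := by exact_mod_cast (show 0 < L by omega)
    positivity
  have hx : 0 ≤ ε / ((L : ℝ) ^ (j + 1)) ^ 2 := by positivity
  have hLx : ((L : ℝ) ^ (j + 1)) ^ 2 * (ε / ((L : ℝ) ^ (j + 1)) ^ 2) = ε := by field_simp
  have hUsP' : IsPeriodicCfg Us ((tower L N (j + 1) : ℕ) : ℤ) := by rw [tower_eq]; exact hUsP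
  have hθ : cruxC 4 L * (((L : ℝ) ^ (j + 1)) ^ 2 * (ε / ((L : ℝ) ^ (j + 1)) ^ 2)) < 1 := by
    rw [hLx]; have := cruxC_le_thetaLoc 4 L; nlinarith
  have hθl : thetaLoc 4 L * (((L : ℝ) ^ (j + 1)) ^ 2 * (ε / ((L : ℝ) ^ (j + 1)) ^ 2)) < 1 := by rw [hLx]; linarith
  have hε' : ((L : ℝ) ^ (j + 1)) ^ 2 * (ε / ((L : ℝ) ^ (j + 1)) ^ 2) ≤ 1 := by rw [hLx]; exact hεone
  -- the smooth curved preimage of `γ`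
  have hφs : IsSkewDir (extDir N (γ : TDir 4 n N)) := fun _ _ => γ.2 _ _
  have hφP : IsPeriodicDir (extDir N (γ : TDir 4 n N)) (N : ℤ) := isPeriodicDir_extDir N _
  set R : Site 4 → Fin 4 → Matrix n n ℂ := rightInvW hL j hUsu hx (hls j) hUsx N hθ hφs with hR
  have hRs : IsSkewDir R := isSkewDir_rightInvW hL j hUsu hx (hls j) hUsx hθ hφs
  have hRP : IsPeriodicDir R ((L * tower L N j : ℕ) : ℤ) := isPeriodicDir_rightInvW hL j hUsu hUsP' hx (hls j) hUsx hθ hφs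
  have hZmem : resDir (L * tower L N j) R ∈ skewSub 4 n (L * tower L N j) := mem_skewSub.mpr fun _ _ => hRs _ _
  have hpre : levelQ' L N j Us (resDir (L * tower L N j) R) = γ := by
    rw [hR, levelQ'_resDir_rightInvW_eq hL j hUsu hUsP' hx (hls j) hUsx hθ hφs hφP, resDir_extDir]
    exact Subtype.ext (skewPF_of_mem γ.2)
  -- the multiplier identity at the preimage (`w = 1` at `d = 4`), read as a first variation
  have hw : ((stepWt 4 L)⁻¹) ^ (j + 1) = 1 := by rw [stepWt_four, inv_one, one_pow]
  have hid := hmult ⟨resDir (L * tower L N j) R, hZmem⟩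
  rw [hw, one_mul, fderiv_fineAction_chart_subtype_apply] at hid
  simp only [] at hid
  rw [hpre, extDir_resDir (L * tower L N j) hRP] at hid
  -- `|dAction U♯ R| ≤ a·Σ‖curl R‖ ≤ a·c₃·M²·‖γ‖_ℓ¹`
  have hD := hasDerivAt_fineAction_vary_at Us R (perWin 4 (N * L ^ (j + 1))) 0
  rw [vary_zero] at hD
  have h1 := abs_firstVariation_le hUsu hRs (perWin 4 (N * L ^ (j + 1))) (fhol_sub_one_le_of_smallField hUsx _) hD
  have h2 := sum_norm_curl_rightInvW_le (N := N) hL j hUsu hUsP' hx (hls j) hUsx hθ hθl hε' hφs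
  rw [← hid]
  have hDl := dirL1_nonneg (extDir N (γ : TDir 4 n N)) (periodBox (d := 4) N)
  have hc3 : 0 ≤ curl1C 4 L / (1 - thetaLoc 4 L * (((L : ℝ) ^ (j + 1)) ^ 2 * (ε / ((L : ℝ) ^ (j + 1)) ^ 2))) := by
    rw [hLx]; exact div_nonneg (curl1C_nonneg 4 L) (by linarith)
  have hfrac : curl1C 4 L / (1 - thetaLoc 4 L * ε) ≤ 2 * curl1C 4 L := by
    rw [div_le_iff₀ (by linarith)]
    nlinarith [curl1C_nonneg 4 L]
  calc |dAction Us R (perWin 4 (N * L ^ (j + 1)))|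
      ≤ ε / ((L : ℝ) ^ (j + 1)) ^ 2 * ∑ p ∈ perWin 4 (N * L ^ (j + 1)), ‖curl Us R p‖ := h1
    _ ≤ ε / ((L : ℝ) ^ (j + 1)) ^ 2 * ((curl1C 4 L / (1 - thetaLoc 4 L * (((L : ℝ) ^ (j + 1)) ^ 2 * (ε / ((L : ℝ) ^ (j + 1)) ^ 2))))
          * (((L : ℝ) ^ (j + 1)) ^ 4 / ((L : ℝ) ^ (j + 1)) ^ 2) * dirL1 (extDir N (γ : TDir 4 n N)) (periodBox (d := 4) N)) :=
        mul_le_mul_of_nonneg_left h2 hx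
    _ = ε * (curl1C 4 L / (1 - thetaLoc 4 L * ε)) * dirL1 (extDir N (γ : TDir 4 n N)) (periodBox (d := 4) N) := by
        rw [hLx]; field_simp
    _ ≤ ε * (2 * curl1C 4 L) * dirL1 (extDir N (γ : TDir 4 n N)) (periodBox (d := 4) N) :=
        mul_le_mul_of_nonneg_right (mul_le_mul_of_nonneg_left hfrac hε.le) hDl
    _ = 2 * curl1C 4 L * ε * dirL1 (extDir N (γ : TDir 4 n N)) (periodBox (d := 4) N) := by ring

/-! ## §3 The top-level multiplier term -/

/-- **THE TOP-LEVEL MULTIPLIER TERM IS `O(ε)·(ℓ² mass of the direction)`** (see the module docstring): in the frame of §2, for every base `W` one averaging step below the top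
(unitary, `SmallField W a`, `512·(4+1)·(4+4)·L²·a ≤ 1`) and every direction `ψ` of the torus `[0, LN)⁴`,
`|Dm(0)[skewPR N (D²(coord L N W)(0)[ψ,ψ])]| ≤ 2·curl1C 4 L·ε·((4∕rho0 4 L²)·(4·(2·nbRad 4 L + 1)^4)·dirSq ψ̃ (periodBox (L·N)))`. [folklore] -/
theorem multiplierTerm_top_le_allData_uniform [Nonempty n] {L : ℕ} [NeZero L] (hL : 2 ≤ L) :
    ∃ ε₀ : ℝ, 0 < ε₀ ∧ ∀ ε : ℝ, 0 < ε → ε ≤ ε₀ → ∀ (N : ℕ) [NeZero N], 1 ≤ N → ∃ δV : ℝ, 0 < δV ∧ ∀ j : ℕ,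
        ∀ V₀ ∈ {V : Site 4 → Fin 4 → (Matrix n n ℂ)ˣ | IsUnitaryCfg V ∧ IsPeriodicCfg V (N : ℤ) ∧ SmallField V δV},
        ∀ Us : Site 4 → Fin 4 → (Matrix n n ℂ)ˣ, IsMinimiser 4 (sfClass 4 L N ε) L N (j + 1) V₀ Us →
        ∀ (W : Site 4 → Fin 4 → (Matrix n n ℂ)ˣ) (a : ℝ), IsUnitaryCfg W → 0 ≤ a → 512 * (4 + 1) * (4 + 4) * (L : ℝ) ^ 2 * a ≤ 1 → SmallField W a →
        ∀ ψ : TDir 4 n (L * N),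
          |fderiv ℝ (fun y : ↥(skewSub 4 n N) => minAct 4 (sfClass 4 L N ε) L N (j + 1) (chart (ContinuousLinearMap.id ℝ (Matrix n n ℂ)) N V₀ (y : TDir 4 n N))) 0
              (skewPR (d := 4) (n := n) N (fderiv ℝ (fderiv ℝ (coord (ContinuousLinearMap.id ℝ (Matrix n n ℂ)) L N W)) 0 ψ ψ))|
            ≤ 2 * curl1C 4 L * ε * (4 / rho0 4 L ^ 2 * ((4 : ℕ) * (2 * nbRad 4 L + 1) ^ 4)
                * dirSq (chartDir (ContinuousLinearMap.id ℝ (Matrix n n ℂ)) (L * N) ψ) (periodBox (d := 4) (L * N))) := by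
  obtain ⟨ε₀, hε₀, H⟩ := multiplier_density_allData_uniform (n := n) hL
  refine ⟨ε₀, hε₀, fun ε hε hεle N _ hN => ?_⟩
  obtain ⟨δV, hδV, H1⟩ := H ε hε hεle N hN
  refine ⟨δV, hδV, fun j V₀ hV₀ Us hUs W a hWu ha hsmall hWa ψ => ?_⟩
  have hL1 : 1 ≤ L := le_trans (by norm_num) hL
  haveI : NeZero (L * N) := ⟨Nat.mul_ne_zero (NeZero.ne L) (NeZero.ne N)⟩
  have h1 := H1 j V₀ hV₀ Us hUs (skewPR (d := 4) (n := n) N (fderiv ℝ (fderiv ℝ (coord (ContinuousLinearMap.id ℝ (Matrix n n ℂ)) L N W)) 0 ψ ψ))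
  have h2 := dirL1_extDir_skewPR_le (fderiv ℝ (fderiv ℝ (coord (ContinuousLinearMap.id ℝ (Matrix n n ℂ)) L N W)) 0 ψ ψ)
  have hsmall' : 512 * ((4 : ℕ) + 1 : ℝ) * ((4 : ℕ) + 4) * (L : ℝ) ^ 2 * a ≤ 1 := by push_cast; linarith
  have h3 := sum_norm_fderiv_fderiv_coord_le (d := 4) hL1 hN hWu ha hsmall' hWa ψ
  have hC : 0 ≤ 2 * curl1C 4 L * ε := by have := curl1C_nonneg 4 L; positivity
  calc _ ≤ 2 * curl1C 4 L * ε * dirL1 (extDir N ((skewPR (d := 4) (n := n) N (fderiv ℝ (fderiv ℝ (coord (ContinuousLinearMap.id ℝ (Matrix n n ℂ)) L N W)) 0 ψ ψ) :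
          ↥(skewSub 4 n N)) : TDir 4 n N)) (periodBox (d := 4) N) := h1
    _ ≤ 2 * curl1C 4 L * ε * ∑ y : Fin 4 → Fin N, ∑ κ : Fin 4, ‖(fderiv ℝ (fderiv ℝ (coord (ContinuousLinearMap.id ℝ (Matrix n n ℂ)) L N W)) 0 ψ ψ) y κ‖ :=
        mul_le_mul_of_nonneg_left h2 hC
    _ ≤ 2 * curl1C 4 L * ε * (4 / rho0 4 L ^ 2 * ((4 : ℕ) * (2 * nbRad 4 L + 1) ^ 4)
          * dirSq (chartDir (ContinuousLinearMap.id ℝ (Matrix n n ℂ)) (L * N) ψ) (periodBox (d := 4) (L * N))) :=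
        mul_le_mul_of_nonneg_left h3 hC

end

end Summit.QuantumFields.BalabanUV.T4Continuum.NE7MultiplierDensity
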